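import Literature.Combinatorics.SimpleGraph.HamiltonianPortGadgetSplice
import Literature.Combinatorics.SimpleGraph.HamiltonianGadgetSubstitutionCount
import Mathlib.Algebra.BigOperators.Fin
import Mathlib.Data.Fin.VecNotation
import Mathlib.Tactic.FinCases
import Mathlib.Tactic.Ring
import HarnessLib

/-!
# Three-port vertex gadgets in Hamiltonian-path counts, III: the counting identity

Conclusion of `HamiltonianPortGadget.lean`, `HamiltonianPathSwap.lean`,
`HamiltonianPortGadgetSplice.lean` (local replacement for COUNTING Hamiltonian paths,
Garey–Johnson 1979, §3.2.2, for a gadget attached at three ports — the Tutte gadget of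
Garey–Johnson–Tarjan 1976 and Liśkiewicz–Ogihara–Toda 2003, §3). For
`h : PortGadget G' V VT x y z a b c M τ` with `b, c ∈ VT`, end points `s, t ∈ V` and constraints
`R, F` on host edges:

* `PortGadget.hamCountRF_eq_sum_orient` — `#Ham(G', R, F) = Σ` over the six ORIENTED pairs of
  ports `(u, v)` of `hamCount G' VT (nb u) (nb v) · |travC u v|` (the constrained Hamiltonian paths
  of `G'` are partitioned by their entry and exit ports, `ncard_travA`);
* `PortGadget.ncard_travC_add` — `|travC u v| + |travC v u| = #Ham(M, R' ∪ {uτ, τv}, F')`;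
* **`PortGadget.hamCountRF_eq`** — the identity by patterns:

  `#Ham(G', R, F) = N(a,c) · #Ham(M, R' ∪ {xτ, τz}, F') + N(b,c) · #Ham(M, R' ∪ {yτ, τz}, F')`
  `                + N(a,b) · #Ham(M, R' ∪ {xτ, τy}, F')`,

  `N(p, q) = hamCount G' VT p q` being the number of Hamiltonian paths of the gadget between two
  of its terminals — for the Tutte gadget `4, 2, 0` (`TutteFragment.lean`, LOT2003 Fig. 1 (b)),
  which is how "(4 · 2)⁴ = 2¹²" for the XOR-gadget is obtained — and `R' = R.image contractEdge`,
  `F' = F.image contractEdge` the translated constraints (`HamiltonianPortGadgetSplice.lean`: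
  admissible constraints are host edges, kept, and port edges `p – nb p`, sent to `p – τ`; this
  is what makes the identity ITERABLE over several mutually adjacent gadgets).

## References

* M. R. Garey, D. S. Johnson, *Computers and Intractability*, Freeman 1979, §3.2.2.
* M. R. Garey, D. S. Johnson, R. E. Tarjan, SIAM J. Comput. 5 (1976) 704–714.
* M. Liśkiewicz, M. Ogihara, S. Toda, TCS 304 (2003) 129–156, §3, Figs. 1–2.
-/

namespace Literature.Combinatorics.SimpleGraph

variable {α : Type*} [DecidableEq α]

/-! ### Consecutive pairs in a list without repeats -/

section pairs

variable {l : List α} {p p' q q' r : α}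

omit [DecidableEq α] in
/-- A list containing `[p, q]` splits as `(L ++ [p]) ++ (q :: R)`. [folklore] -/
theorem exists_split_of_pair_infix (h : [p, q] <:+: l) : ∃ L R, l = (L ++ [p]) ++ (q :: R) := by
  obtain ⟨L, R, rfl⟩ := h
  exact ⟨L, R, by simp⟩

omit [DecidableEq α] in
/-- **The predecessor of an entry of a list without repeats is unique.** [folklore] -/
theorem pred_unique_of_nodup (hl : l.Nodup) (h₁ : [p, q] <:+: l) (h₂ : [p', q] <:+: l) : p' = p := by
  obtain ⟨L, R, rfl⟩ := exists_split_of_pair_infix h₁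
  have hnd := hl
  rw [List.nodup_append'] at hnd
  obtain ⟨-, hndR, hdis⟩ := hnd
  have hqL : q ∉ L ++ [p] := fun hq => hdis hq List.mem_cons_self
  have hqR : q ∉ R := (List.nodup_cons.1 hndR).1
  rcases pair_infix_append_iff.1 h₂ with h | h | ⟨h₁, -⟩
  · exact absurd (mem_of_pair_infix h).2 hqL
  · rcases pair_infix_cons_iff.1 h with ⟨-, hh⟩ | h
    · exact absurd (List.mem_of_mem_head? hh) hqR
    · exact absurd (mem_of_pair_infix h).2 hqR
  · have : p = p' := by simpa using h₁
    exact this.symm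

omit [DecidableEq α] in
/-- **The successor of an entry of a list without repeats is unique.** [folklore] -/
theorem succ_unique_of_nodup (hl : l.Nodup) (h₁ : [p, q] <:+: l) (h₂ : [p, q'] <:+: l) : q' = q := by
  have h₁' : [q, p] <:+: l.reverse := by simpa using List.reverse_infix.2 h₁
  have h₂' : [q', p] <:+: l.reverse := by simpa using List.reverse_infix.2 h₂
  exact pred_unique_of_nodup (List.nodup_reverse.2 hl) h₁' h₂'

omit [DecidableEq α] in
/-- Consecutive entries of a list without repeats differ. [folklore] -/
theorem ne_of_pair_infix_of_nodup (hl : l.Nodup) (h : [p, q] <:+: l) : p ≠ q := by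
  have := hl.sublist h.sublist
  simp only [List.nodup_cons, List.mem_singleton, List.not_mem_nil, not_false_eq_true,
    List.nodup_nil, and_true] at this
  exact this

omit [DecidableEq α] in
/-- **Two overlapping consecutive pairs form a consecutive triple.** [folklore] -/
theorem triple_infix_of_nodup (hl : l.Nodup) (h₁ : [p, q] <:+: l) (h₂ : [q, r] <:+: l) :
    [p, q, r] <:+: l := by
  obtain ⟨L, R, rfl⟩ := exists_split_of_pair_infix h₁
  have hpq : p ≠ q := ne_of_pair_infix_of_nodup hl h₁
  have hnd := hl
  rw [List.nodup_append'] at hnd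
  obtain ⟨-, hndR, hdis⟩ := hnd
  have hqL : q ∉ L ++ [p] := fun hq => hdis hq List.mem_cons_self
  have hqR : q ∉ R := (List.nodup_cons.1 hndR).1
  rcases pair_infix_append_iff.1 h₂ with h | h | ⟨h₁, -⟩
  · exact absurd (mem_of_pair_infix h).1 hqL
  · rcases pair_infix_cons_iff.1 h with ⟨-, hh⟩ | h
    · obtain ⟨R', rfl⟩ : ∃ R', R = r :: R' := by
        rcases R with _ | ⟨d, R'⟩
        · simp at hh
        · simp only [List.head?_cons, Option.some.injEq] at hh
          exact ⟨R', by rw [hh]⟩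
      exact ⟨L, R', by simp⟩
    · exact absurd (mem_of_pair_infix h).1 hqR
  · simp only [List.getLast?_append, List.getLast?_singleton, Option.some_or, Option.some.injEq] at h₁
    exact absurd h₁ hpq

end pairs

namespace PortGadget

variable {G' M : _root_.SimpleGraph α} {V VT : Finset α} {x y z a b c τ : α}
  (h : PortGadget G' V VT x y z a b c M τ)
include h

variable {s t : α} {R F : Finset (α × α)}

/-! ### Both orientations of a pattern together -/

/-- **`|travC u v| + |travC v u| = #Ham(M, R ∪ {uτ, τv}, F)`**: a base path uses both star edges
`u τ` and `τ v` iff it passes `u, τ, v` or `v, τ, u`. [cite: GareyJohnson1979, §3.2.2] -/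
theorem ncard_travC_add {u v : α} (huv : u ≠ v) :
    (h.travC s t R F u v).ncard + (h.travC s t R F v u).ncard =
      hamCountRF M (insert τ V) s t (R ∪ {(u, τ), (τ, v)}) F := by
  have hfin : ∀ p q, (h.travC s t R F p q).Finite := fun p q =>
    (hamSetRF_finite M (insert τ V) s t R F).subset fun l hl => hl.1
  have hset : hamSetRF M (insert τ V) s t (R ∪ {(u, τ), (τ, v)}) F =
      h.travC s t R F u v ∪ h.travC s t R F v u := by
    ext l
    constructor
    · rintro ⟨hl, hRall, hF⟩
      have hl' : l ∈ hamSetRF M (insert τ V) s t R F :=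
        ⟨hl, fun e he => hRall e (Finset.mem_union_left _ he), hF⟩
      have hu := hRall (u, τ) (by simp)
      have hv := hRall (τ, v) (by simp)
      rcases hu with hu | hu <;> rcases hv with hv | hv
      · exact Or.inl ⟨hl', triple_infix_of_nodup hl.1 hu hv⟩
      · exact absurd (pred_unique_of_nodup hl.1 hu hv) (Ne.symm huv)
      · exact absurd (succ_unique_of_nodup hl.1 hu hv) (Ne.symm huv)
      · exact Or.inr ⟨hl', triple_infix_of_nodup hl.1 hv hu⟩
    · rintro (⟨⟨hl, hR, hF⟩, hinf⟩ | ⟨⟨hl, hR, hF⟩, hinf⟩)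
      · refine ⟨hl, fun e he => ?_, hF⟩
        rcases Finset.mem_union.1 he with he | he
        · exact hR e he
        · simp only [Finset.mem_insert, Finset.mem_singleton] at he
          rcases he with rfl | rfl
          · exact Or.inl ((List.infix_append [] [u, τ] [v]).trans hinf)
          · exact Or.inl ((List.infix_append [u] [τ, v] []).trans (by simpa using hinf))
      · refine ⟨hl, fun e he => ?_, hF⟩
        rcases Finset.mem_union.1 he with he | he
        · exact hR e he
        · simp only [Finset.mem_insert, Finset.mem_singleton] at he
          rcases he with rfl | rfl
          · exact Or.inr ((List.infix_append [v] [τ, u] []).trans (by simpa using hinf))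
          · exact Or.inr ((List.infix_append [] [v, τ] [u]).trans hinf)
  have hdis : Disjoint (h.travC s t R F u v) (h.travC s t R F v u) := by
    rw [Set.disjoint_left]
    rintro l ⟨⟨hl, -⟩, h₁⟩ ⟨-, h₂⟩
    have h₁' : [u, τ] <:+: l := (List.infix_append [] [u, τ] [v]).trans h₁
    have h₂' : [v, τ] <:+: l := (List.infix_append [] [v, τ] [u]).trans h₂
    exact huv (pred_unique_of_nodup hl.1 h₂' h₁')
  rw [hamCountRF, hset, Set.ncard_union_eq hdis (hfin u v) (hfin v u)]

/-! ### The six oriented pairs of ports -/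

/-- The six oriented pairs of distinct ports, patterns `{x,z}`, `{y,z}`, `{x,y}` in this order.
[cite: GareyJohnson1979, §3.2.2] -/
def orient (_ : PortGadget G' V VT x y z a b c M τ) : Fin 6 → α × α :=
  ![(x, z), (z, x), (y, z), (z, y), (x, y), (y, x)]

omit [DecidableEq α] in
/-- The oriented pairs consist of distinct ports. [folklore] -/
theorem orient_ports (i : Fin 6) :
    h.IsPort (h.orient i).1 ∧ h.IsPort (h.orient i).2 ∧ (h.orient i).1 ≠ (h.orient i).2 := by
  have h1 := h.x_ne_y; have h2 := h.x_ne_z; have h3 := h.y_ne_z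
  unfold IsPort orient
  fin_cases i <;> simp [h1, h2, h3, h1.symm, h2.symm, h3.symm]

omit [DecidableEq α] in
/-- The six oriented pairs are pairwise distinct. [folklore] -/
theorem orient_injective : Function.Injective h.orient := by
  have h1 := h.x_ne_y; have h2 := h.x_ne_z; have h3 := h.y_ne_z
  intro i j hij
  unfold orient at hij
  fin_cases i <;> fin_cases j <;> simp_all [Prod.ext_iff]

omit [DecidableEq α] in
/-- Every oriented pair of distinct ports is listed. [folklore] -/
theorem exists_orient_eq {u v : α} (hu : h.IsPort u) (hv : h.IsPort v) (huv : u ≠ v) :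
    ∃ i, h.orient i = (u, v) := by
  unfold orient
  rcases hu with rfl | rfl | rfl <;> rcases hv with rfl | rfl | rfl
  · exact absurd rfl huv
  · exact ⟨4, by simp⟩
  · exact ⟨0, by simp⟩
  · exact ⟨5, by simp⟩
  · exact absurd rfl huv
  · exact ⟨2, by simp⟩
  · exact ⟨1, by simp⟩
  · exact ⟨3, by simp⟩
  · exact absurd rfl huv

/-! ### The partition of the Hamiltonian paths of `G'` by entry and exit port -/

/-- Every constrained Hamiltonian path of `G'` is a traversal for one of the six oriented pairs.
[cite: GareyJohnson1979, §3.2.2] -/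
theorem exists_mem_travA (hsV : s ∈ V) (htV : t ∈ V) {l' : List α}
    (hl' : l' ∈ hamSetRF G' (V ∪ VT) s t R F) : ∃ i, l' ∈ h.travA s t R F (h.orient i).1 (h.orient i).2 := by
  obtain ⟨l₁, l₂, u₀, v₀, xs, hshape, hu₀, hv₀, hne, hxs, -, -⟩ := h.decomp hsV htV hl'.1
  obtain ⟨i, hi⟩ := h.exists_orient_eq hu₀ hv₀ hne
  refine ⟨i, ?_⟩
  rw [hi]
  refine ⟨hl', ?_, ?_⟩
  · obtain ⟨xs', hxs'⟩ : ∃ xs', xs = h.nb u₀ :: xs' := by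
      have hh := hxs.2.2.1
      rcases xs with _ | ⟨d, xs'⟩
      · simp at hh
      · simp only [List.head?_cons, Option.some.injEq] at hh
        exact ⟨xs', by rw [hh]⟩
    exact ⟨l₁, xs' ++ v₀ :: l₂, by rw [hshape, hxs']; simp⟩
  · obtain ⟨xs', hxs'⟩ := List.getLast?_eq_some_iff.1 hxs.2.2.2.1
    exact ⟨l₁ ++ u₀ :: xs', l₂, by rw [hshape, hxs']; simp⟩

/-- Traversals for different oriented pairs are different paths. [folklore] -/
theorem travA_disjoint (hbT : b ∈ VT) (hcT : c ∈ VT) (hsV : s ∈ V) (htV : t ∈ V) {i j : Fin 6}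
    (hij : i ≠ j) :
    Disjoint (h.travA s t R F (h.orient i).1 (h.orient i).2) (h.travA s t R F (h.orient j).1 (h.orient j).2) := by
  rw [Set.disjoint_left]
  rintro l' ⟨hl', hin, hout⟩ ⟨-, hin', hout'⟩
  obtain ⟨l₁, l₂, u₀, v₀, xs, hshape, hu₀, hv₀, -, hxs, hl₁, hl₂⟩ := h.decomp hsV htV hl'.1
  obtain ⟨hpi1, hpi2, -⟩ := h.orient_ports i
  obtain ⟨hpj1, hpj2, -⟩ := h.orient_ports j
  rw [hshape] at hin hout hin' hout'
  have e1 := h.entry_port_eq hbT hcT hu₀ hv₀ hxs hl₁ hl₂ hpi1 hin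
  have e2 := h.entry_port_eq hbT hcT hu₀ hv₀ hxs hl₁ hl₂ hpj1 hin'
  have e3 := h.exit_port_eq hbT hcT hu₀ hv₀ hxs hl₁ hl₂ hpi2 hout
  have e4 := h.exit_port_eq hbT hcT hu₀ hv₀ hxs hl₁ hl₂ hpj2 hout'
  exact hij (h.orient_injective (Prod.ext (e1.trans e2.symm) (e3.trans e4.symm)))

/-- **The count by oriented pairs**: the constrained Hamiltonian `s`–`t` paths of `G'` number
`Σᵢ hamCount G' VT (nb uᵢ) (nb vᵢ) · |travC uᵢ vᵢ|` over the six oriented pairs `(uᵢ, vᵢ)` of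
ports. [cite: GareyJohnson1979, §3.2.2 (local replacement)] -/
theorem hamCountRF_eq_sum_orient (hbT : b ∈ VT) (hcT : c ∈ VT) (hsV : s ∈ V) (htV : t ∈ V)
    (hR : ∀ e ∈ R, h.Admissible e) (hF : ∀ e ∈ F, h.Admissible e) :
    hamCountRF G' (V ∪ VT) s t R F =
      ∑ i : Fin 6, hamCount G' VT (h.nb (h.orient i).1) (h.nb (h.orient i).2) *
        (h.travC s t (R.image h.contractEdge) (F.image h.contractEdge)
          (h.orient i).1 (h.orient i).2).ncard := by
  have hset : hamSetRF G' (V ∪ VT) s t R F =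
      ⋃ i ∈ (Finset.univ : Finset (Fin 6)), h.travA s t R F (h.orient i).1 (h.orient i).2 := by
    ext l'
    simp only [Set.mem_iUnion, Finset.mem_univ, exists_true_left]
    exact ⟨fun hl' => h.exists_mem_travA hsV htV hl', fun ⟨i, hi⟩ => hi.1⟩
  rw [hamCountRF, hset, ncard_biUnion_of_disjoint _ _ (fun i _ =>
      (hamSetRF_finite G' (V ∪ VT) s t R F).subset fun l hl => hl.1)
    (fun i _ j _ hij => h.travA_disjoint hbT hcT hsV htV hij)]
  exact Finset.sum_congr rfl fun i _ =>
    h.ncard_travA hbT hcT hsV htV hR hF (h.orient_ports i).1 (h.orient_ports i).2.1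

/-- **The three-port gadget identity** (local replacement for counting Hamiltonian paths, vertex
version): with `N(p, q) = hamCount G' VT p q` the number of Hamiltonian paths of the gadget
between its terminals,

`#Ham(G', R, F) = N(a,c)·#Ham(M, R' ∪ {xτ,τz}, F') + N(b,c)·#Ham(M, R' ∪ {yτ,τz}, F') + N(a,b)·#Ham(M, R' ∪ {xτ,τy}, F')`,

`R', F'` the translated constraints (`contractEdge`: host edges unchanged, a port edge `p – nb p`
becomes `p – τ`); the constraints `R, F` may be host edges or port edges (`Admissible`). For the
Tutte gadget `N(a,c), N(b,c), N(a,b) = 4, 2, 0` (LOT2003, Fig. 1 (b)).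
[cite: GareyJohnson1979, §3.2.2 (local replacement)] -/
theorem hamCountRF_eq (hbT : b ∈ VT) (hcT : c ∈ VT) (hsV : s ∈ V) (htV : t ∈ V)
    (hR : ∀ e ∈ R, h.Admissible e) (hF : ∀ e ∈ F, h.Admissible e) :
    hamCountRF G' (V ∪ VT) s t R F =
      hamCount G' VT a c * hamCountRF M (insert τ V) s t
        (R.image h.contractEdge ∪ {(x, τ), (τ, z)}) (F.image h.contractEdge) +
      hamCount G' VT b c * hamCountRF M (insert τ V) s t
        (R.image h.contractEdge ∪ {(y, τ), (τ, z)}) (F.image h.contractEdge) +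
      hamCount G' VT a b * hamCountRF M (insert τ V) s t
        (R.image h.contractEdge ∪ {(x, τ), (τ, y)}) (F.image h.contractEdge) := by
  rw [h.hamCountRF_eq_sum_orient hbT hcT hsV htV hR hF, Fin.sum_univ_six]
  simp only [orient, Matrix.cons_val_zero, Matrix.cons_val_one, Matrix.cons_val, nb_x, nb_y, nb_z]
  rw [← h.ncard_travC_add (R := R.image h.contractEdge) (F := F.image h.contractEdge) (s := s) (t := t) h.x_ne_z,
    ← h.ncard_travC_add (R := R.image h.contractEdge) (F := F.image h.contractEdge) (s := s) (t := t) h.y_ne_z,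
    ← h.ncard_travC_add (R := R.image h.contractEdge) (F := F.image h.contractEdge) (s := s) (t := t) h.x_ne_y]
  have r1 : hamCount G' VT c a = hamCount G' VT a c := hamCountRF_reverse G' VT c a ∅ ∅
  have r2 : hamCount G' VT c b = hamCount G' VT b c := hamCountRF_reverse G' VT c b ∅ ∅
  have r3 : hamCount G' VT b a = hamCount G' VT a b := hamCountRF_reverse G' VT b a ∅ ∅
  rw [r1, r2, r3]
  ring

end PortGadget

end Literature.Combinatorics.SimpleGraph
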